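/-
Copyright: cell `langlands-arthur-audit` (papers/Langlands/langlands-arthur-audit), unit `pub-arthur-typer-g17`
(LEAN TYPER gen 17, 2026-08-19).  Staged for the tree under `Literature/NumberTheory/Automorphic/Arthur2013/Leaves/`
(LEAN-IN-TREE rule 2026-08-18); imports `Leaves.DescentLevis` (M55).  Module map: M62 (the packet id).
v1.1: docstring-only re-stamp of v1 (two `d⁻` wordings); declarations byte-identical.
-/
import Literature.NumberTheory.Automorphic.Arthur2013.Leaves.DescentLevis

/-!
# Leaves · census of engine L (M55), III: the weighted data of `GL_7 θ_7`, kernel-computed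

Companion of `Leaves/DescentLevis` (M55; sources and readings there) and of `Leaves/DescentLevisCensus` (M58, the
`d = 6` census).  For `d = 7`, every row of M50's tables with `M̃ ≠ G̃` (Levi types `GL_1 × GL_5 × GL_1`, `GL_2 ×
GL_3 × GL_2`, `GL_3 × GL_1 × GL_3`, and the two-block types `GL_1 × GL_1 × GL_3 × GL_1 × GL_1`, `GL_1 × GL_2 × GL_1
× GL_2 × GL_1`, `GL_2 × GL_1 × GL_1 × GL_1 × GL_2`; the chunks exhaust `d = 7` by `dRows_7_chunks`), every
configuration and every admissible tag choice (`716` tagged data on `490` data): every tag choice is `good` (M55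
`DTag.good`), and the data admitting an ESSENTIALLY OPEN tag choice are exactly the `16` of `essential7` — `8` on
`GL_1 × GL_5 × GL_1` (`3` with `d⁻ = 3`, `5` with `d⁻ = 5`), `5` on `GL_2 × GL_3 × GL_2` (`d⁻ = 3`), none on
`GL_3 × GL_1 × GL_3`, `3` on `GL_1 × GL_1 × GL_3 × GL_1 × GL_1` (`d⁻ = 3`) — out of M52's `18` open-capable data with
`d = 7`; the `2` others (`GL_1 × GL_1 × GL_3 × GL_1 × GL_1`, `d⁻ = 3`, `y ∈ {(-1, c, -1), (c, -1, -1)}`) invoke NO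
weighted identity for any tag choice, with `a_Ḡ ∩ a_{M̃} ≠ 0` (`levis_vacuous_7`), as the `4` vacuous data of `d = 6`
(M55 `levis_vacuous_6`).  By M55
`DTag.scope_of_essOpen`, at each of the `16` some admissible tag choice invokes an identity of [W4] 3.6 at a Lie
scope that is needed and not supplied in print in the cell's reading; M52's witness `Diagram.witnessOdd7` is the
first entry of `essential7`.

What is NOT claimed: as in M55; nothing beyond `d = 7`; the rows with `M̃ = G̃` are not traversed.
-/

set_option autoImplicit false

namespace Literature.NumberTheory.Automorphic.Arthur2013.Leaves

open NonStd BasePoint Diagram ODiagram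

namespace LeviSet

/-- the three chunks and the rows with `M̃ = G̃` exhaust `d = 7`. [folklore] (kernel evaluation) -/
theorem dRows_7_chunks :
    (dRowsFor 7).all (fun x => x.row.gl == [] || x.row.gl == [1] || (x.row.gl == [2] || x.row.gl == [3]) ||
      decide (2 ≤ x.row.gl.length)) = true := by
  decide +kernel

/-- **`d = 7`, Levi `GL_1 × GL_5 × GL_1`** (all `d⁻`, configurations, tags: `279` tagged data): certified, and the
essentially open data are the `8` listed (`3` with `d⁻ = 3`, `5` with `d⁻ = 5`). [folklore] (kernel evaluation) -/
theorem levis7_gl1 :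
    certify ((dRowsFor 7).filter (fun x => x.row.gl == [1])) =
      [(⟨7, [1], 5, 3⟩, [.negOne, .negOne, .one], true), (⟨7, [1], 5, 3⟩, [.negOne, .negOne, .negOne], true),
       (⟨7, [1], 5, 3⟩, [.negOne, .negOne, .gen 0], true), (⟨7, [1], 5, 5⟩, [.negOne, .one, .negOne], true),
       (⟨7, [1], 5, 5⟩, [.negOne, .negOne, .one], true), (⟨7, [1], 5, 5⟩, [.negOne, .negOne, .negOne], true),
       (⟨7, [1], 5, 5⟩, [.negOne, .negOne, .gen 0], true), (⟨7, [1], 5, 5⟩, [.negOne, .gen 0, .negOne], true)] := by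
  rw [show (dRowsFor 7).filter (fun x => x.row.gl == [1]) = dRowsWith 7 (fun r => r.gl == [1]) from
      dRowsFor_filter_row 7 (fun r => r.gl == [1])]
  decide +kernel

/-- **`d = 7`, Levi `GL_2 × GL_3 × GL_2` or `GL_3 × GL_1 × GL_3`** (`202` tagged data): certified, and the
essentially open data are the `5` listed (all on `GL_2 × GL_3 × GL_2`, `d⁻ = 3`). [folklore] (kernel evaluation) -/
theorem levis7_gl23 :
    certify ((dRowsFor 7).filter (fun x => x.row.gl == [2] || x.row.gl == [3])) =
      [(⟨7, [2], 3, 3⟩, [.one, .negOne, .negOne], true), (⟨7, [2], 3, 3⟩, [.negOne, .one, .negOne], true),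
       (⟨7, [2], 3, 3⟩, [.negOne, .negOne, .negOne], true), (⟨7, [2], 3, 3⟩, [.negOne, .gen 0, .negOne], true),
       (⟨7, [2], 3, 3⟩, [.gen 0, .negOne, .negOne], true)] := by
  rw [show (dRowsFor 7).filter (fun x => x.row.gl == [2] || x.row.gl == [3]) =
      dRowsWith 7 (fun r => r.gl == [2] || r.gl == [3]) from dRowsFor_filter_row 7 (fun r => r.gl == [2] || r.gl == [3])]
  decide +kernel

/-- **`d = 7`, two `GL`-block pairs** (`235` tagged data): certified, and the essentially open data are the `3`
listed (`GL_1 × GL_1 × GL_3 × GL_1 × GL_1`, `d⁻ = 3`). [folklore] (kernel evaluation) -/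
theorem levis7_blocks :
    certify ((dRowsFor 7).filter (fun x => decide (2 ≤ x.row.gl.length))) =
      [(⟨7, [1, 1], 3, 3⟩, [.one, .negOne, .negOne], true), (⟨7, [1, 1], 3, 3⟩, [.negOne, .one, .negOne], true),
       (⟨7, [1, 1], 3, 3⟩, [.negOne, .negOne, .negOne], true)] := by
  rw [show (dRowsFor 7).filter (fun x => decide (2 ≤ x.row.gl.length)) = dRowsWith 7 (fun r => decide (2 ≤ r.gl.length)) from
      dRowsFor_filter_row 7 (fun r => decide (2 ≤ r.gl.length))]
  decide +kernel

/-- **`d = 7`: the open-capable data of M52 that invoke NO weighted identity**, for every tag choice: exactly the `2`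
listed, and at each of them `a_Ḡ ∩ a_{M̃} ≠ 0` for every tag choice (the class of multiplicity one on the outer
block pair gives a split central torus of `Ḡ` inside `a_{M̃}`), so that every coefficient `d^{G̃}_{R̄}(M̃, L̄)`
vanishes and the right-hand side of [W4] Prop. 5.4 (ii) is an empty sum. [folklore] (kernel evaluation) -/
theorem levis_vacuous_7 :
    ((dRowsFor 7).filter (fun x => x.openCapable && (tagsOf x).all (fun i => i.result.invoked.isEmpty))).map
        (fun x => (x.row, x.y)) =
      [(⟨7, [1, 1], 3, 3⟩, [.negOne, .gen 0, .negOne]), (⟨7, [1, 1], 3, 3⟩, [.gen 0, .negOne, .negOne])] ∧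
    ((dRowsFor 7).filter (fun x => x.openCapable && (tagsOf x).all (fun i => i.result.invoked.isEmpty))).all
        (fun x => (tagsOf x).all (fun i => i.toLData.centreMeetsWeight && i.result.m == 2)) = true := by
  constructor
  · decide +kernel
  · decide +kernel

/-- the `16` weighted data `(row, configuration)` of `GL_7 θ_7` admitting an essentially open tag choice (every tag
choice at every `d = 7` datum with `M̃ ≠ G̃` being `good`), read off `levis7_gl1`, `levis7_gl23`, `levis7_blocks`;
the first entry is the datum of M52 `Diagram.witnessOdd7`. [folklore] (executable list) -/
def essential7 : List (Row × Config) :=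
  [(⟨7, [1], 5, 3⟩, [.negOne, .negOne, .one]), (⟨7, [1], 5, 3⟩, [.negOne, .negOne, .negOne]),
   (⟨7, [1], 5, 3⟩, [.negOne, .negOne, .gen 0]), (⟨7, [1], 5, 5⟩, [.negOne, .one, .negOne]),
   (⟨7, [1], 5, 5⟩, [.negOne, .negOne, .one]), (⟨7, [1], 5, 5⟩, [.negOne, .negOne, .negOne]),
   (⟨7, [1], 5, 5⟩, [.negOne, .negOne, .gen 0]), (⟨7, [1], 5, 5⟩, [.negOne, .gen 0, .negOne]),
   (⟨7, [2], 3, 3⟩, [.one, .negOne, .negOne]), (⟨7, [2], 3, 3⟩, [.negOne, .one, .negOne]),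
   (⟨7, [2], 3, 3⟩, [.negOne, .negOne, .negOne]), (⟨7, [2], 3, 3⟩, [.negOne, .gen 0, .negOne]),
   (⟨7, [2], 3, 3⟩, [.gen 0, .negOne, .negOne]), (⟨7, [1, 1], 3, 3⟩, [.one, .negOne, .negOne]),
   (⟨7, [1, 1], 3, 3⟩, [.negOne, .one, .negOne]), (⟨7, [1, 1], 3, 3⟩, [.negOne, .negOne, .negOne])]

/-- **census `d = 7`**: over the three chunks (all rows with `M̃ ≠ G̃`, cf. `dRows_7_chunks`) the data returned by
`certify` are exactly `essential7`, each with the flag « every tag choice good ». [folklore] (kernel evaluation) -/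
theorem census7 :
    certify ((dRowsFor 7).filter (fun x => x.row.gl == [1])) ++
      (certify ((dRowsFor 7).filter (fun x => x.row.gl == [2] || x.row.gl == [3])) ++
        certify ((dRowsFor 7).filter (fun x => decide (2 ≤ x.row.gl.length)))) =
      essential7.map (fun p => (p.1, p.2, true)) := by
  rw [levis7_gl1, levis7_gl23, levis7_blocks]; decide

/-- the datum of M52's `witnessOdd7` heads `essential7`. [folklore] (kernel evaluation) -/
theorem witnessOdd7_essential : essential7.head? = some (witnessOdd7.x.row, witnessOdd7.x.y) := by
  decide

end LeviSet

end Literature.NumberTheory.Automorphic.Arthur2013.Leaves
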